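import Summits.KontsevichZagierPeriods.KontsevichZagierPeriods.Theorems.SymplecticScissorsVolumeFormOffPlaneAffineOrbitPairs
import Literature.NumberTheory.Transcendental.KZBallPeeling

/-!
# `VolumeFormOffPlane` (stmt-KontsevichZagierPeriods-14935) — line `Sketch`:
ELLIPSOID PAIRS (the affine-orbit sector of the unit ball, every dimension)

The affine-orbit pairs theorem of the line (`affineOrbitPairs`, fed by the Euclidean affine sector
of `OffTetraSectorKernel` and the line's signed-scissors layer) specialised to the open unit ball
`B_d = {∑ zᵢ² < 1}`: two integrand-`1` representations of dimension `d` whose domains are,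
almost everywhere, `ℤ`-combinations of indicators of real-algebraic open ELLIPSOIDS `A B_d + b`
(`det A ≠ 0`), with equal volume, are KZ-equivalent. A non-polyhedral instance of the frame
`VolumeForm` in every dimension (volumes in `ℚ̄ · vol B_d`, e.g. `4π/3 · |det A|` for `d = 3`):
e.g. any two finite disjoint unions of algebraic ellipsoids of equal total volume.

Sources: Kontsevich–Zagier 2001, §1.2 rules (1), (2); folklore.
-/

noncomputable section

open MeasureTheory Set
open Literature.NumberTheory.Transcendental
open Literature.ModelTheory.ExponentialFields (IsSemialgebraic)

namespace Summit.KontsevichZagierPeriods.SymplecticScissors.LogPolytope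

/-- The open unit ball has finite Lebesgue volume (it sits in the cube `[−1, 1]ᵈ`). [folklore] -/
theorem elp_volume_ball_ne_top (d : ℕ) :
    volume {z : Fin d → ℝ | ∑ i, (z i) ^ 2 < 1} ≠ ⊤ := by
  refine ((measure_mono fun z hz => ?_).trans_lt
    (isCompact_univ_pi fun _ : Fin d => isCompact_Icc (a := (-1 : ℝ)) (b := 1)).measure_lt_top).ne
  have hz' : ∑ i, (z i) ^ 2 < 1 := hz
  simp only [mem_univ_pi, mem_Icc]
  intro i
  have hi : (z i) ^ 2 ≤ ∑ j, (z j) ^ 2 :=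
    Finset.single_le_sum (fun j _ => sq_nonneg (z j)) (Finset.mem_univ i)
  exact abs_le.1 ((sq_le_one_iff_abs_le_one (z i)).1 (by linarith))

/-- **ELLIPSOID PAIRS (every dimension).** Two integrand-`1` representations of dimension `d`
whose domains are, almost everywhere, `ℤ`-combinations of indicators of domains of integrand-`1`
representations on real-algebraic open ellipsoids — affine images `A B_d + b` of the open unit
ball with `A`, `b` real algebraic and `det A ≠ 0`, required where the weight is non-zero — and
whose values agree are KZ-equivalent (`affineOrbitPairs` for the body `B_d`,
`KZ.BallPeeling.isSemialgebraic_ball`). [folklore] -/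
theorem ellipsoidPairs :
    ∀ (d : ℕ) (r r' : KZ.IntegralRep d) (k k' : ℕ) (ρ : Fin k → KZ.IntegralRep d)
        (ρ' : Fin k' → KZ.IntegralRep d) (c : Fin k → ℤ) (c' : Fin k' → ℤ),
      (∀ x ∈ r.domain, r.integrand x = 1) → (∀ x ∈ r'.domain, r'.integrand x = 1) →
      (∀ i, ∀ x ∈ (ρ i).domain, (ρ i).integrand x = 1) →
      (∀ i, ∀ x ∈ (ρ' i).domain, (ρ' i).integrand x = 1) →
      (∀ i, c i ≠ 0 → ∃ (A : Matrix (Fin d) (Fin d) ℝ) (b : Fin d → ℝ),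
        (∀ j l, IsAlgebraic ℚ (A j l)) ∧ (∀ j, IsAlgebraic ℚ (b j)) ∧ A.det ≠ 0 ∧
        (ρ i).domain = (fun x => A.mulVec x + b) '' {z : Fin d → ℝ | ∑ i, (z i) ^ 2 < 1}) →
      (∀ i, c' i ≠ 0 → ∃ (A : Matrix (Fin d) (Fin d) ℝ) (b : Fin d → ℝ),
        (∀ j l, IsAlgebraic ℚ (A j l)) ∧ (∀ j, IsAlgebraic ℚ (b j)) ∧ A.det ≠ 0 ∧
        (ρ' i).domain = (fun x => A.mulVec x + b) '' {z : Fin d → ℝ | ∑ i, (z i) ^ 2 < 1}) →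
      (∀ᵐ x : Fin d → ℝ, r.domain.indicator (fun _ => (1 : ℝ)) x =
        ∑ i, (c i : ℝ) * (ρ i).domain.indicator (fun _ => (1 : ℝ)) x) →
      (∀ᵐ x : Fin d → ℝ, r'.domain.indicator (fun _ => (1 : ℝ)) x =
        ∑ i, (c' i : ℝ) * (ρ' i).domain.indicator (fun _ => (1 : ℝ)) x) →
      r.value = r'.value → KZ.Equivalent r r' := fun d =>
  affineOrbitPairs d _ (KZ.BallPeeling.isSemialgebraic_ball d) (elp_volume_ball_ne_top d)

end Summit.KontsevichZagierPeriods.SymplecticScissors.LogPolytope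

end
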